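/-
Copyright (c) 2026 the pub-hodgecm-mathlib formalisation cell (harness21).  Prover seat hodgecm-mathlib-K2E4-p11 (g7): Track B «K2-LIT»,
#184♮ = hLiu418 = stmt-HodgeConjecture-24832; Road Φ of socket #41, Φ9 consumer sheet ROW G2 — the per-place glue (LEAD F0P6-plan (g14) BATCH #47 (1),
desk K2Liu-p12 (g4) spec 2026-09-04T15:03:44Z), file 1 of 2: the WHOLE local Whittaker integral at a good unimodular place on the Skew carrier.
-/
import Summits.HodgeConjecture.HodgeConjecture.Theorems.K2LiuGoodPlaceWhittakerUnimodularValueCM   -- ★ E7 (K2Liu-p12): `setIntegral_whittaker_unimodular_eq_of_parity_inert∕_split` (value on `B(−3)`)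
import Summits.HodgeConjecture.HodgeConjecture.Theorems.K2LiuGoodPlaceWhittakerBound              -- ★ Φ4 (K2Liu-p12): (i) `goodPlace_farShell_eq_zero`; brings ★ Φ5-tie `whittaker_integral_eq_setIntegral_ball`
import HarnessLib

/-!
# Crux `HLiu418`, Road Φ of socket #41, ROW G2's PER-PLACE GLUE, FILE 1 — THE WHOLE LOCAL WHITTAKER INTEGRAL AT A GOOD UNIMODULAR PLACE, SKEW CARRIER:
# `∫_{Skew} φ_s(w_Δ n(t)) ψ_v(−τ tr(β t)) dμ(t) = μ(B(0)) · (1 − q_v^{−(2s+1)})(1 − α q_v^{−(2s+2)})`,  `α = ∏_{w∣v} χ_w(ι_w ϖ)` (`= ε(ϖ_v)` under parity)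

Cell `hodgecm-mathlib`, crux item hLiu418 = `stmt-HodgeConjecture-24832`, route of record `HCCMUnconditional`; squad K2 ∕ K2Liu, road `K2_Liu`,
socket #41 `sig_K2LiuSiegelEisensteinContinuation`, Road Φ; Φ9 consumer sheet row G2, the organ between rows G1 and G2 (desk K2Liu-p12 (g4) 15:03:44Z:
«★ B4 → Skew integral, ★ Φ5-tie `∫_S = ∫_{B(−3)}` with `hshell` = ★ Φ4 (i), ★ E7 value at `B(−3)`, ★ B2 volume»).  THIS FILE = the Skew-carrier half: Φ5-tie ∘ Φ4 (i) ∘ E7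
in the GENERIC local frame `(F, E, c, δ, v, n = 2, T₀, JD, S, μ)` of those files, letters VERBATIM from ★ E7's `Heads` block; file 2 (`K2LiuGoodPlaceLocalFactor`) transports it
to row G1's `∫_{unipDeltaLoc v} conj ψ_S(ι_v y)·Λ_{s,v}((w_Δ)_v y) dν_v` by ★ B4 ∕ ★ B2 in the CM frame.  THEOREMS ONLY (no `def`, no `instance`, no `notation`, no named-fact
hypothesis, no `sorry`); lane `--supports stmt-HodgeConjecture-24832 --as helper` (count-neutral helper; closes no socket by itself).

THE MATHEMATICS [Casselman1980, §3], [Shimura1997, §18], [Liu2011, §2A (2-10)].  At a good place (`|2|_w = 1`, `ψ_v` of conductor exponent `0`, `T = T₀ ⊗ 1` and `T⁻¹`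
integral, `χ_w` unramified, `ε` an anti-invariant unit) and for a `v`-UNIMODULAR `T`-skew index `β` (`β, β⁻¹` integral), the far shells `B(−k) ∖ B(−k+1)`, `k ≥ 4`, of the Skew
lattice contribute `0` to `∫ φ_s(w_Δ n(t)) ψ_v(−τ tr(β t)) dμ` for EVERY member of a spherical family `φ_s` (★ Φ4 (i) `goodPlace_farShell_eq_zero` with
`d = c_ε = c₂ = b = b′ = 0`, threshold `4`); so wherever the integrand is integrable (`hint`, e.g. `1 < re s`) the whole integral IS the ball integral over `B(−3)` (★ Φ5-tie
`whittaker_integral_eq_setIntegral_ball`, `K = 4`), whose value is ★ E7 §6: `μ(B(0))·(1 − q_v^{−(2s+1)})(1 − α·q_v^{−(2s+2)})` under the parity letter `α = −1` (inert) ∕ `α = 1` (split),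
`α := ∏_{w∣v} χ_w(ι_w ϖ)`.  After the consumer reads `α = ε(ϖ_v)` this is the letter `hW` of ★ G1 `K2LiuGoodPlaceWhittakerEulerAssembly.hasProd_whittaker_div_vol` with
`W v := ∫ …`, `m v := μ(B(0))`.
* §1 `farShell_eq_zero_unimodular` — ★ Φ4 (i) specialised to the good unimodular letters of ★ E7's `Heads` block (all exponents `0`; threshold `4 ≤ k`).
* §2 `integral_whittaker_eq_setIntegral_ball_three` — `∫_S = ∫_{B(−3)}` for every spherical family member with integrable integrand (★ Φ5-tie at `K = 4`).
* §3 HEADS **`integral_whittaker_eq_of_parity_inert`** ∕ **`integral_whittaker_eq_of_parity_split`** — the displayed value of the WHOLE integral (§2 + ★ E7 §6).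
VISIBLE LETTERS: ★ E7's `Heads` block verbatim (`hd hJD w₀ S hS μ h2v hT hTinv hTb hTib hχur hϖ0 hψ hdψ hτ hτadd hτs hτc h2F hεσ hεint hε h2 hβs hββ hβ0 hβinv0`), Φ4's
`[LocallyCompactSpace S] [μ.Regular]`, `μF`, the spherical FAMILY `hφ : ∀ s, IsSphericalSection … s (φ s)` (★ `K2LiuSphericalSectionLambdaLoc.isSphericalSection_lambdaLoc` pays it for
`Λ_{s,v}`), `hint` (★ `K2LiuSiegelIntertwiningIntegrable.integrable_weylDelta_mul` on `1 < re s`, transported in file 2), and the parity letter `hα`.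
HONEST LABEL.  Count-neutral helper; it retires nothing by itself: `HC_CM` is proved only modulo the 7 printed citations (2 remaining named inputs:
hLiu418 = `stmt-HodgeConjecture-24832`, h413 = `stmt-HodgeConjecture-24833`) until rung 0 closes.

## References
* [Casselman1980] W. Casselman, *The unramified principal series of p-adic groups I*, Compositio Math. 40 (1980), §3.
* [Shimura1997] G. Shimura, *Euler products and Eisenstein series*, CBMS 93 (1997), §13, §18.
* [Liu2011] Y. Liu, *Arithmetic theta lifting and L-derivatives for unitary groups, I*, Algebra Number Theory 5 (2011): §2A p. 936 (2-10).
* [KudlaRallis1994] S. Kudla, S. Rallis, Ann. of Math. 140 (1994), §2.   * [HarrisKudlaSweet1996] M. Harris, S. Kudla, W. J. Sweet, J. AMS 9 (1996), §6 (6.16).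
-/

set_option autoImplicit false
-- the mandated namespace repeats the single-problem summit's segment (`HodgeConjecture.HodgeConjecture`)
set_option linter.dupNamespace false

noncomputable section

open scoped NNReal ENNReal Matrix Topology
open NumberField IsDedekindDomain Matrix MeasureTheory Set Filter
open Literature.NumberTheory.GaloisRepresentations Literature.NumberTheory.GaloisRepresentations.IsNonarchimedeanLocalField
open Literature.NumberTheory.Automorphic Literature.NumberTheory.Automorphic.UnitaryGroup
open Literature.NumberTheory.GelbartRogawski1991.AdaptedBlocks
open Literature.NumberTheory.GelbartRogawski1991.UnitaryDualPair.LocalSplitting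
open Literature.NumberTheory.K2Lit.LocalSiegelDoubled
open Summit.HodgeConjecture.HodgeConjecture.Cruxes.HLiu418.K2LiuGoodPlaceWhittakerUnimodularValueCM (setIntegral_whittaker_unimodular_eq_of_parity_inert setIntegral_whittaker_unimodular_eq_of_parity_split)
open Summit.HodgeConjecture.HodgeConjecture.Cruxes.HLiu418.K2LiuGoodPlaceWhittakerBound (goodPlace_farShell_eq_zero)
open Summit.HodgeConjecture.HodgeConjecture.Cruxes.HLiu418.K2LiuBadPlaceWhittakerEntire (whittaker_integral_eq_setIntegral_ball)

namespace Summit.HodgeConjecture.HodgeConjecture.Cruxes.HLiu418.K2LiuGoodPlaceWhittakerSkewValue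

variable (F : Type) [Field F] [NumberField F] (E : Type) [Field E] [NumberField E] [Algebra F E]
  [Algebra.IsQuadraticExtension F E] (c : E ≃ₐ[F] E) {δ : E} (hcδ : c δ = -δ) (hδ : δ ≠ 0)
  (v : HeightOneSpectrum (𝓞 F))
  {π : v.adicCompletion F} (hπ : Valued.v π = WithZero.exp (-1 : ℤ)) (hπw : ∀ w : PlacesOver E v, Valued.v (toPlace v w π) = WithZero.exp (-1 : ℤ))

/-! The letters of ★ E7's `Heads` block, VERBATIM (good unimodular place: all conductor∕integrality exponents are `0`). -/
variable {dd : F} (hd : δ * δ = algebraMap F E dd) {T₀ : Matrix (Fin 2) (Fin 2) F}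
  {JD : Matrix (Fin (2 + 2)) (Fin (2 + 2)) E} (hJD : JD = (gramD F 2 T₀).map (algebraMap F E)) (w₀ : PlacesOver E v)
  (S : AddSubgroup (Matrix (Fin 2) (Fin 2) (LocalRing E v)))
  (hS : ∀ t, t ∈ S ↔ (t.map (conjLocal E c v))ᵀ * gramS F E v 2 T₀ + gramS F E v 2 T₀ * t = 0)
  [MeasurableSpace S] [BorelSpace S] (μ : Measure S) [μ.IsAddHaarMeasure]
  (h2v : ∀ w : PlacesOver E v, ValuativeRel.valuation (w.1.adicCompletion E) (2 : w.1.adicCompletion E) = 1)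
  (hT : ∀ (w : PlacesOver E v) (i j : Fin 2),
    ValuativeRel.valuation (w.1.adicCompletion E) (algebraMap E (w.1.adicCompletion E) (algebraMap F E (T₀ i j))) ≤ 1)
  (hTinv : ∀ (w : PlacesOver E v) (i j : Fin 2),
    ValuativeRel.valuation (w.1.adicCompletion E) (algebraMap E (w.1.adicCompletion E) (algebraMap F E (T₀⁻¹ i j))) ≤ 1)
  (hTb : ∀ i j (w : PlacesOver E v), Valued.v (gramS F E v 2 T₀ i j w) ≤ Valued.v (toPlace v w π) ^ (0 : ℤ))
  (hTib : ∀ i j (w : PlacesOver E v), Valued.v ((gramS F E v 2 T₀)⁻¹ i j w) ≤ Valued.v (toPlace v w π) ^ (0 : ℤ))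
  {χv : ∀ w : PlacesOver E v, (w.1.adicCompletion E)ˣ →* ℂˣ}
  (hχur : ∀ (w : PlacesOver E v) (x : (w.1.adicCompletion E)ˣ), Valued.v (x : w.1.adicCompletion E) = 1 → χv w x = 1)
  (hϖ0 : ∀ w : PlacesOver E v, toPlace v w π ≠ 0)
  {s : ℂ} {φs : UnitaryGroup.localPi E c (2 + 2) JD v → ℂ}
  {ψ : AddChar (v.adicCompletion F) Circle} (hψ : Continuous ψ) (hdψ : ψ.HasConductorExp 0)
  {τ : LocalRing E v → v.adicCompletion F} (hτ : ∀ r, toLocalRing E v (τ r) = r + conjLocal E c v r) (hτadd : ∀ r s, τ (r + s) = τ r + τ s)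
  (hτs : ∀ (z : v.adicCompletion F) (r : LocalRing E v), τ (toLocalRing E v z * r) = z * τ r) (hτc : Continuous τ)
  (h2F : Valued.v (2 : v.adicCompletion F) = 1)
  {ε : LocalRing E v} (hεσ : conjLocal E c v ε = -ε) (hεint : ∀ w : PlacesOver E v, Valued.v (ε w) ≤ 1)
  (hε : ∀ w : PlacesOver E v, Valued.v (toPlace v w π) ^ (0 : ℤ) ≤ Valued.v ((2 * ε) w))
  (h2 : ∀ w : PlacesOver E v, Valued.v (toPlace v w π) ^ (0 : ℤ) ≤ Valued.v ((2 : LocalRing E v) w))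
  {β βinv : Matrix (Fin 2) (Fin 2) (LocalRing E v)} (hβs : (β.map (conjLocal E c v))ᵀ * gramS F E v 2 T₀ + gramS F E v 2 T₀ * β = 0)
  (hββ : β * βinv = 1) (hβ0 : ∀ i j (w : PlacesOver E v), Valued.v (β i j w) ≤ Valued.v (toPlace v w π) ^ (0 : ℤ))
  (hβinv0 : ∀ i j (w : PlacesOver E v), Valued.v (βinv i j w) ≤ Valued.v (toPlace v w π) ^ (0 : ℤ))



/-! ## §1 Far shells at a good unimodular place: threshold `4` -/

include hπ h2v hTb hTib hχur hψ hdψ hτ hτadd hτs hτc hεσ hεint hε h2 hβs hββ hβ0 hβinv0 in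
/-- **FAR SHELLS VANISH FROM `k = 4` ON** — ★ Φ4 (i) `goodPlace_farShell_eq_zero` read at the good unimodular letters of ★ E7 (`d = c_ε = c₂ = 0`, `β, β⁻¹ ∈ B(0)`: `b = b′ = 0`,
threshold `4 + |0| + 2|0| + 2|0| + 0 + 0 = 4`): for every member `φ_s` of a spherical family and every `k ≥ 4`, `∫_{B(−k) ∖ B(−k+1)} φ_s(w_Δ n(t)) ψ_v(−τ tr(β t)) dμ = 0`.
[cite: Casselman1980, §3] [cite: Shimura1997, §18] -/
theorem farShell_eq_zero_unimodular (hT₀ : T₀.IsSymm) (hT₀d : IsUnit T₀.det)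
    [LocallyCompactSpace S] [μ.Regular]
    [MeasurableSpace (v.adicCompletion F)] [BorelSpace (v.adicCompletion F)] (μF : Measure (v.adicCompletion F)) [μF.IsAddHaarMeasure]
    {φ : ℂ → UnitaryGroup.localPi E c (2 + 2) JD v → ℂ} (hφ : ∀ s, IsSphericalSection F E c hcδ hδ hd v 2 hT₀ hJD χv s (φ s))
    (s : ℂ) {k : ℤ} (hk : 4 ≤ k) :
    ∫ t in {t : S | ∀ i j (w : PlacesOver E v), Valued.v (t.1 i j w) ≤ Valued.v (toPlace v w π) ^ (-k)} \
        {t : S | ∀ i j (w : PlacesOver E v), Valued.v (t.1 i j w) ≤ Valued.v (toPlace v w π) ^ (-k + 1)},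
      φ s (weylDelta F E c v 2 hJD * nElem F E c v 2 hJD t.1 ((hS t.1).1 t.2)) * ((ψ (-τ (Matrix.trace (β * t.1))) : Circle) : ℂ) ∂μ = 0 :=
  goodPlace_farShell_eq_zero (F := F) (E := E) (c := c) (hcδ := hcδ) (hδ := hδ) (hd := hd) (v := v) (hT₀ := hT₀) (hT₀d := hT₀d) (hJD := hJD) (hπ := hπ) (S := S) (hS := hS) (μ := μ) (μF := μF) (h2v := h2v) (hTb := hTb) (hTib := hTib) (hχur := hχur) (hφ := hφ) (hψ := hψ) (hdψ := hdψ) (hτ := hτ) (hτadd := hτadd) (hτs := hτs) (hτc := hτc) (hεσ := hεσ) (hεint := hεint) (hε := hε) (h2 := h2) (hββ := hββ)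
    (n := 2) (b := 0) (b' := 0) (β := β) (βinv := βinv) (hb := le_rfl) (hb' := le_rfl) (hβskew := hβs)
    (hβ := fun i j w => by rw [neg_zero]; exact hβ0 i j w) (hβinv := fun i j w => by rw [neg_zero]; exact hβinv0 i j w)
    (s := s) (k := k) (hk := by simp only [abs_zero, mul_zero, add_zero]; exact hk)

/-! ## §2 The whole integral is the ball integral over `B(−3)` -/

include hπ h2v hTb hTib hχur hψ hdψ hτ hτadd hτs hτc hεσ hεint hε h2 hβs hββ hβ0 hβinv0 in
/-- **`∫_{Skew} = ∫_{B(−3)}`** for every member of a spherical family whose weighted pull-back is integrable (★ Φ5-tie `whittaker_integral_eq_setIntegral_ball` at `K = 4`, `hshell` = §1).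
[cite: Casselman1980, §3] [cite: Shimura1997, §18] -/
theorem integral_whittaker_eq_setIntegral_ball_three (hT₀ : T₀.IsSymm) (hT₀d : IsUnit T₀.det)
    [LocallyCompactSpace S] [μ.Regular]
    [MeasurableSpace (v.adicCompletion F)] [BorelSpace (v.adicCompletion F)] (μF : Measure (v.adicCompletion F)) [μF.IsAddHaarMeasure]
    {φ : ℂ → UnitaryGroup.localPi E c (2 + 2) JD v → ℂ} (hφ : ∀ s, IsSphericalSection F E c hcδ hδ hd v 2 hT₀ hJD χv s (φ s))
    (s : ℂ)
    (hint : Integrable (fun t : S => φ s (weylDelta F E c v 2 hJD * nElem F E c v 2 hJD t.1 ((hS t.1).1 t.2)) * ((ψ (-τ (Matrix.trace (β * t.1))) : Circle) : ℂ)) μ) :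
    ∫ t, φ s (weylDelta F E c v 2 hJD * nElem F E c v 2 hJD t.1 ((hS t.1).1 t.2)) * ((ψ (-τ (Matrix.trace (β * t.1))) : Circle) : ℂ) ∂μ =
      ∫ t in {t : S | ∀ i j (w : PlacesOver E v), Valued.v (t.1 i j w) ≤ Valued.v (toPlace v w π) ^ (-3 : ℤ)},
        φ s (weylDelta F E c v 2 hJD * nElem F E c v 2 hJD t.1 ((hS t.1).1 t.2)) * ((ψ (-τ (Matrix.trace (β * t.1))) : Circle) : ℂ) ∂μ := by
  have h := whittaker_integral_eq_setIntegral_ball (F := F) (E := E) (v := v) (hπ := hπ) (n := 2) (S := S) (μ := μ)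
    (φ := fun (s' : ℂ) (t : S) => φ s' (weylDelta F E c v 2 hJD * nElem F E c v 2 hJD t.1 ((hS t.1).1 t.2)))
    (χ := fun t : S => ((ψ (-τ (Matrix.trace (β * t.1))) : Circle) : ℂ)) (K := 4)
    (hshell := fun s' k hk => farShell_eq_zero_unimodular (F := F) (E := E) (c := c) (hcδ := hcδ) (hδ := hδ) (hd := hd) (v := v) (hT₀ := hT₀) (hT₀d := hT₀d) (hJD := hJD) (hπ := hπ) (S := S) (hS := hS) (μ := μ) (μF := μF) (h2v := h2v) (hTb := hTb) (hTib := hTib) (hχur := hχur) (hφ := hφ) (hψ := hψ) (hdψ := hdψ) (hτ := hτ) (hτadd := hτadd) (hτs := hτs) (hτc := hτc) (hεσ := hεσ) (hεint := hεint) (hε := hε) (h2 := h2) (hβs := hβs) (hββ := hββ) (hβ0 := hβ0) (hβinv0 := hβinv0) s' hk) (s := s) (hint := hint)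
  rw [show (-((4 : ℤ) - 1)) = (-3 : ℤ) by norm_num] at h
  exact h

/-! ## §3 HEADS: the value of the whole local Whittaker integral under the parity letter -/

include hcδ hδ hd hJD hπ hπw hS h2v hT hTinv hTb hTib hχur hϖ0 hψ hdψ hτ hτadd hτs hτc h2F hεσ hεint hε h2 hβs hββ hβ0 hβinv0 in
/-- **THE WHOLE LOCAL WHITTAKER INTEGRAL AT A GOOD UNIMODULAR INERT PLACE** (`c • w₀ = w₀`, `δ` a unit above `v`, parity letter `α = −1`):
**`∫_{Skew} φ_s(w_Δ n(t)) ψ_v(−τ tr(β t)) dμ = μ(B(0)) · ((1 − q_v^{−(2s+1)}) · (1 − α · q_v^{−(2s+2)}))`** — §2 + ★ E7 `setIntegral_whittaker_unimodular_eq_of_parity_inert`.  With `α = ε(ϖ_v)`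
(★ `K2E1QuadraticHeckeCharCMPlaceValues.valueAtUniformizer_quadraticHeckeCharCM_of_nonsplit`) this is ★ G1 `hasProd_whittaker_div_vol`'s letter `hW` at `v` (`W v` = the integral,
`m v = μ(B(0))`). [cite: Liu2011, §2A (2-10)] [cite: Shimura1997, §18] [cite: Casselman1980, §3] -/
theorem integral_whittaker_eq_of_parity_inert (hT₀ : T₀.IsSymm) (hT₀d : IsUnit T₀.det)
    [LocallyCompactSpace S] [μ.Regular]
    [MeasurableSpace (v.adicCompletion F)] [BorelSpace (v.adicCompletion F)] (μF : Measure (v.adicCompletion F)) [μF.IsAddHaarMeasure]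
    {φ : ℂ → UnitaryGroup.localPi E c (2 + 2) JD v → ℂ} (hφ : ∀ s, IsSphericalSection F E c hcδ hδ hd v 2 hT₀ hJD χv s (φ s))
    (hw₀ : c • w₀.1 = w₀.1) (hδu : ∀ w : PlacesOver E v, Valued.v (algebraMap E (LocalRing E v) δ w) = 1)
    (hα : (((∏ w : PlacesOver E v, χv w (Units.mk0 (toPlace v w π) (hϖ0 w))) : ℂˣ) : ℂ) = -1)
    (s : ℂ)
    (hint : Integrable (fun t : S => φ s (weylDelta F E c v 2 hJD * nElem F E c v 2 hJD t.1 ((hS t.1).1 t.2)) * ((ψ (-τ (Matrix.trace (β * t.1))) : Circle) : ℂ)) μ) :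
    ∫ t, φ s (weylDelta F E c v 2 hJD * nElem F E c v 2 hJD t.1 ((hS t.1).1 t.2)) * ((ψ (-τ (Matrix.trace (β * t.1))) : Circle) : ℂ) ∂μ =
      (μ.real {t : S | ∀ i j (w : PlacesOver E v), Valued.v (t.1 i j w) ≤ Valued.v (toPlace v w π) ^ (0 : ℤ)} : ℂ) *
        ((1 - (v.residueCard : ℂ) ^ (-(2 * s + 1))) *
          (1 - (((∏ w : PlacesOver E v, χv w (Units.mk0 (toPlace v w π) (hϖ0 w))) : ℂˣ) : ℂ) * (v.residueCard : ℂ) ^ (-(2 * s + 2)))) := by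
  rw [integral_whittaker_eq_setIntegral_ball_three (F := F) (E := E) (c := c) (hcδ := hcδ) (hδ := hδ) (hd := hd) (v := v) (hT₀ := hT₀) (hT₀d := hT₀d) (hJD := hJD) (hπ := hπ) (S := S) (hS := hS) (μ := μ) (μF := μF) (h2v := h2v) (hTb := hTb) (hTib := hTib) (hχur := hχur) (hφ := hφ) (hψ := hψ) (hdψ := hdψ) (hτ := hτ) (hτadd := hτadd) (hτs := hτs) (hτc := hτc) (hεσ := hεσ) (hεint := hεint) (hε := hε) (h2 := h2) (hβs := hβs) (hββ := hββ) (hβ0 := hβ0) (hβinv0 := hβinv0) s hint]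
  exact setIntegral_whittaker_unimodular_eq_of_parity_inert (F := F) (E := E) (c := c) (hcδ := hcδ) (hδ := hδ) (v := v) (hπ := hπ) (hπw := hπw) (hd := hd) (hT₀ := hT₀) (hT₀d := hT₀d) (hJD := hJD) (w₀ := w₀) (S := S) (hS := hS) (μ := μ) (h2v := h2v) (hT := hT) (hTinv := hTinv) (hTb := hTb) (hTib := hTib) (hχur := hχur) (hϖ0 := hϖ0) (hψ := hψ) (hdψ := hdψ) (hτ := hτ) (hτadd := hτadd) (hτs := hτs) (hτc := hτc) (h2F := h2F) (hεσ := hεσ) (hεint := hεint) (hε := hε) (h2 := h2) (hβs := hβs) (hββ := hββ) (hβ0 := hβ0) (hβinv0 := hβinv0) (hφ := hφ s) (hw₀ := hw₀) (hδu := hδu) (hα := hα)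

include hcδ hδ hd hJD hπ hπw hS h2v hT hTinv hTb hTib hχur hϖ0 hψ hdψ hτ hτadd hτs hτc h2F hεσ hεint hε h2 hβs hββ hβ0 hβinv0 in
/-- **THE WHOLE LOCAL WHITTAKER INTEGRAL AT A GOOD UNIMODULAR SPLIT PLACE** (`c • w₀ ≠ w₀`, parity letter `α = 1`): the same value — §2 + ★ E7
`setIntegral_whittaker_unimodular_eq_of_parity_split`; with `α = ε(ϖ_v) = 1` (★ `valueAtUniformizer_quadraticHeckeCharCM_of_split`) it is G1's `hW` at `v`.
[cite: Liu2011, §2A (2-10)] [cite: Shimura1997, §18] [cite: Casselman1980, §3] -/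
theorem integral_whittaker_eq_of_parity_split (hT₀ : T₀.IsSymm) (hT₀d : IsUnit T₀.det)
    [LocallyCompactSpace S] [μ.Regular]
    [MeasurableSpace (v.adicCompletion F)] [BorelSpace (v.adicCompletion F)] (μF : Measure (v.adicCompletion F)) [μF.IsAddHaarMeasure]
    {φ : ℂ → UnitaryGroup.localPi E c (2 + 2) JD v → ℂ} (hφ : ∀ s, IsSphericalSection F E c hcδ hδ hd v 2 hT₀ hJD χv s (φ s))
    (hw₀ : c • w₀.1 ≠ w₀.1)
    (hα : (((∏ w : PlacesOver E v, χv w (Units.mk0 (toPlace v w π) (hϖ0 w))) : ℂˣ) : ℂ) = 1)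
    (s : ℂ)
    (hint : Integrable (fun t : S => φ s (weylDelta F E c v 2 hJD * nElem F E c v 2 hJD t.1 ((hS t.1).1 t.2)) * ((ψ (-τ (Matrix.trace (β * t.1))) : Circle) : ℂ)) μ) :
    ∫ t, φ s (weylDelta F E c v 2 hJD * nElem F E c v 2 hJD t.1 ((hS t.1).1 t.2)) * ((ψ (-τ (Matrix.trace (β * t.1))) : Circle) : ℂ) ∂μ =
      (μ.real {t : S | ∀ i j (w : PlacesOver E v), Valued.v (t.1 i j w) ≤ Valued.v (toPlace v w π) ^ (0 : ℤ)} : ℂ) *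
        ((1 - (v.residueCard : ℂ) ^ (-(2 * s + 1))) *
          (1 - (((∏ w : PlacesOver E v, χv w (Units.mk0 (toPlace v w π) (hϖ0 w))) : ℂˣ) : ℂ) * (v.residueCard : ℂ) ^ (-(2 * s + 2)))) := by
  rw [integral_whittaker_eq_setIntegral_ball_three (F := F) (E := E) (c := c) (hcδ := hcδ) (hδ := hδ) (hd := hd) (v := v) (hT₀ := hT₀) (hT₀d := hT₀d) (hJD := hJD) (hπ := hπ) (S := S) (hS := hS) (μ := μ) (μF := μF) (h2v := h2v) (hTb := hTb) (hTib := hTib) (hχur := hχur) (hφ := hφ) (hψ := hψ) (hdψ := hdψ) (hτ := hτ) (hτadd := hτadd) (hτs := hτs) (hτc := hτc) (hεσ := hεσ) (hεint := hεint) (hε := hε) (h2 := h2) (hβs := hβs) (hββ := hββ) (hβ0 := hβ0) (hβinv0 := hβinv0) s hint]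
  exact setIntegral_whittaker_unimodular_eq_of_parity_split (F := F) (E := E) (c := c) (hcδ := hcδ) (hδ := hδ) (v := v) (hπ := hπ) (hπw := hπw) (hd := hd) (hT₀ := hT₀) (hT₀d := hT₀d) (hJD := hJD) (w₀ := w₀) (S := S) (hS := hS) (μ := μ) (h2v := h2v) (hT := hT) (hTinv := hTinv) (hTb := hTb) (hTib := hTib) (hχur := hχur) (hϖ0 := hϖ0) (hψ := hψ) (hdψ := hdψ) (hτ := hτ) (hτadd := hτadd) (hτs := hτs) (hτc := hτc) (h2F := h2F) (hεσ := hεσ) (hεint := hεint) (hε := hε) (h2 := h2) (hβs := hβs) (hββ := hββ) (hβ0 := hβ0) (hβinv0 := hβinv0) (hφ := hφ s) (hw₀ := hw₀) (hα := hα)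

end Summit.HodgeConjecture.HodgeConjecture.Cruxes.HLiu418.K2LiuGoodPlaceWhittakerSkewValue

end
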